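import Literature.NumberTheory.DiophantineGeometry.BelyiDegreeThree
import Literature.NumberTheory.DiophantineGeometry.BelyiLemmaProofs
import HarnessLib

/-!
# Belyi maps on elliptic curves through the double cover: `deg_B(E) ≤ 2 · deg_B(ℙ¹; e₁, e₂, e₃, ∞)`

Topic `NumberTheory/DiophantineGeometry`; sequel of `BelyiDegreeThree.lean` (the double cover
`x : E → ℙ¹`, `[K(W) : K(x)] = 2`, simple fibres away from the `2`-torsion) and bridge between the
two Belyi degrees of the tree: the Belyi degree `AlgFunctionField.belyiDegree` of a curve
(`BelyiDegreeFaltingsHeight.lean`, the quantity of Javanpeykar's Thm. 1.1.1) and the pointed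
genus-`0` Belyi degree of a four-pointed line (`BelyiDegree.lean`, `HasBelyiWitness` /
`belyiDegree t`, used by the ABC routes). The standard construction [Javanpeykar 2014, §1.1:
`deg_B` "is the minimal degree of a finite morphism `X → ℙ¹` unramified over `{0, 1, ∞}`"; for an
elliptic curve one composes the double cover with a Belyi map of `ℙ¹` moving its four branch points
to `{0, 1, ∞}`]: for `W : y² = x³ + a₂x² + a₄x + a₆` elliptic over `K` algebraically closed of
characteristic `0` and `β = p/q ∈ K(X)` (`p, q` coprime, `d = max (deg p) (deg q) ≥ 1`) with
`β(∞) ∈ {0,1,∞}`, finite critical values in `{0, 1}` and `β(e) ∈ {0,1,∞}` at the roots `e` of the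
cubic:

* `WeierstrassBelyi.isBelyiFunction_aeval_div` — **`β(x) = p(x)/q(x)` is a Belyi function on
  `K(W)`** (at a zero `P` of `β(x) - c`, `c ≠ 0,1`, over `x = α`:
  `v_P = mult_α(p - cq) · v_P(x - α)` with both factors `1`);
* `WeierstrassBelyi.finrank_adjoin_aeval_div` — **`[K(W) : K(β(x))] = 2d`** exactly (pole count:
  `2 · mult_α(q)` over each root `α` of `q`, plus `2(deg p - deg q)` at `P_∞` if positive);
* `WeierstrassBelyi.belyiDegree_le_two_mul` — hence **`deg_B(K(W)) ≤ 2d`**;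
* `WeierstrassBelyi.belyiDegree_legendre_le` — for the Legendre curve `y² = x(x - 1)(x - λ)` the
  hypotheses are exactly the clauses of `HasBelyiWitness d λ` (with coefficients in `K`):
  **`deg_B(E_λ) ≤ 2 · deg_B(ℙ¹; 0, 1, ∞, λ)`** for `K`-rational witnesses.

* `WeierstrassBelyi.belyiDegree_legendre_le_of_eq_div` — with Belyi's polynomials
  `c x^{m+1} (1-x)^{n+1}` (`BelyiLemmaProofs`: `belyiPoly_critical`, `belyiPoly_eval_lambda`):
  **`deg_B(E_λ) ≤ 2(m + n + 2)` for `λ = (m+1)/(m+n+2)`**, i.e. `deg_B(E_{a/c}) ≤ 2c`;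
* `belyiDegree_legendre_baseChange_le`, `javanpeykar2014_stableFaltingsHeight_le.legendre` — in the
  setting of the named fact (Legendre/Frey curves over number fields): `deg_B(E_{λ,Ω}) ≤ 2(m+n+2)`
  and, modulo the fact, **`h_F(E_λ) ≤ 13·10⁶ (2(m+n+2))⁵`** (`≤ 4.16·10⁸ c⁵` for `λ = a/c`).

Theorems only; no definition, no named fact. (The witnesses of `BelyiDegree.HasBelyiWitness` have
complex coefficients; transferring a `ℂ`-witness to `ℚ̄` is Belyi descent and is not addressed.)

## References

* A. Javanpeykar, *Polynomial bounds for Arakelov invariants of Belyi curves*, Algebra & Number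
  Theory 8 (2014), §1.1 and Thm. 1.1.1. [Javanpeykar2014]
* J. H. Silverman, *The Arithmetic of Elliptic Curves*, 2nd ed., GTM 106 (2009), Prop. III.3.1,
  Cor. III.3.1.1. [SilvermanAEC2009]
* E. Bombieri, W. Gubler, *Heights in Diophantine Geometry*, CUP (2006), proof of Lemma 12.2.7,
  p. 406 (Belyi's polynomials). [BombieriGubler2006]
-/

noncomputable section

open scoped IntermediateField Polynomial.Bivariate
open Polynomial WithZero

namespace Literature.NumberTheory.DiophantineGeometry

open AlgFunctionField WeierstrassPlaceAtInfinity WeierstrassPlaces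

universe u

variable {K : Type u} [Field K] (W : WeierstrassCurve.Affine K)

/-- The function `y ∈ K(W)`. -/
local notation "yF" W => algebraMap (WeierstrassCurve.Affine.CoordinateRing W)
  (WeierstrassCurve.Affine.FunctionField W) (WeierstrassCurve.Affine.CoordinateRing.mk W Y)

/-- The function `x ∈ K(W)`. -/
local notation "xF" W => algebraMap (Polynomial K) (WeierstrassCurve.Affine.FunctionField W) X

namespace WeierstrassBelyi

variable [IsDedekindDomain W.CoordinateRing] [IsAlgClosed K]

/-- At a finite place of `K(W)` (all places but `P_∞`), `x` is integral and takes a value `α ∈ K`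
with `v_P(x - α) > 0`. [folklore] -/
theorem exists_ord_x_sub_pos {P : PlaceOver K W.FunctionField} (hP : P ≠ infPlace W) :
    ∃ α : K, 0 < P.ord ((xF W) - algebraMap K W.FunctionField α) := by
  have hrat : ∀ P : PlaceOver K W.FunctionField, P.IsRational :=
    PlaceOver.isRational_of_isAlgClosed
  have hxO : (xF W) ∈ P.toValuationSubring := by
    rcases eq_infPlace_or_exists_eq_ofPrime W P with rfl | ⟨v, rfl⟩
    · exact absurd rfl hP
    · exact x_mem_ofPrime W v
  obtain ⟨α, hα⟩ := (hrat P).exists_sub_algebraMap_mem hxO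
  have hne : (xF W) - algebraMap K W.FunctionField α ≠ 0 :=
    fun h ↦ x_not_mem_range W ⟨α, (sub_eq_zero.1 h).symm⟩
  exact ⟨α, (P.mem_ball_iff_le_ord 1 hne).1 hα⟩

/-- **Belyi maps through the double cover.** Let `W : y² = x³ + a₂x² + a₄x + a₆` be elliptic over
`K` algebraically closed of characteristic `0`, and let `β = p/q ∈ K(X)` (`p, q` coprime,
`d = max (deg p) (deg q) ≥ 1`) be a rational function of `ℙ¹` with `β(∞) ∈ {0, 1, ∞}` (a degree
drops), all finite critical values in `{0, 1}` (at `z` with `q(z) ≠ 0` and `(p'q - pq')(z) = 0`,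
`β(z) ∈ {0, 1}`), and `β(e) ∈ {0, 1, ∞}` at the three roots `e` of the cubic (the finite branch
points of `x`): `(p q (p - q))(e) = 0`. Then `f = β(x) = p(x)/q(x)` is a Belyi function on `K(W)`: a
zero `P` of `f - c`, `c ≠ 0, 1`, lies over `x = α` with `q(α) ≠ 0`, and
`v_P(f - c) = mult_α(p - cq) · v_P(x - α)` with both factors `1` (`α` is neither a critical point of
`β` nor a branch point of `x`, since `β(α) = c ∉ {0, 1}`). This is the construction
`E → ℙ¹ → ℙ¹` bounding the Belyi degree of an elliptic curve by twice the Belyi degree of the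
four-pointed line `(ℙ¹; e₁, e₂, e₃, ∞)`. [cite: Javanpeykar2014, §1.1] -/
theorem isBelyiFunction_aeval_div [W.IsElliptic] [CharZero K] (h₁ : W.a₁ = 0) (h₃ : W.a₃ = 0)
    {p q : K[X]} (hcop : IsCoprime p q) (hd : 0 < max p.natDegree q.natDegree)
    (hdrop : p.natDegree < max p.natDegree q.natDegree ∨ q.natDegree < max p.natDegree q.natDegree ∨
      (p - q).natDegree < max p.natDegree q.natDegree)
    (hcrit : ∀ z : K, q.eval z ≠ 0 → (derivative p * q - p * derivative q).eval z = 0 →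
      p.eval z = 0 ∨ p.eval z = q.eval z)
    (hbranch : ∀ z : K, z ^ 3 + W.a₂ * z ^ 2 + W.a₄ * z + W.a₆ = 0 → (p * q * (p - q)).eval z = 0) :
    IsBelyiFunction K (aeval (xF W) p / aeval (xF W) q) := by
  classical
  set x := (xF W) with hx
  have hxK : x ∉ Set.range (algebraMap K W.FunctionField) := x_not_mem_range W
  have hxt : Transcendental K x := by
    haveI := isIntegrallyClosedIn_of_isAlgClosed (K := K) (F := W.FunctionField)
    exact transcendental_of_not_mem_range hxK
  have hinj : Function.Injective (aeval x : K[X] →ₐ[K] W.FunctionField) :=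
    (transcendental_iff_injective.1 hxt)
  have hp0 : p ≠ 0 ∨ q ≠ 0 := by
    by_contra h
    push Not at h
    rw [h.1, h.2, natDegree_zero, max_self] at hd
    exact lt_irrefl _ hd
  have hq0 : q ≠ 0 := by
    rintro rfl
    have hpunit : IsUnit p := isCoprime_zero_right.1 hcop
    rw [natDegree_eq_zero_of_isUnit hpunit, natDegree_zero, max_self] at hd
    exact lt_irrefl _ hd
  have haq : aeval x q ≠ 0 := fun h ↦ hq0 (hinj (by rw [h, map_zero]))
  set f := aeval x p / aeval x q with hf
  have hcoprime_eval : ∀ z : K, p.eval z = 0 → q.eval z = 0 → False := by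
    intro z hpz hqz
    obtain ⟨a, b, hab⟩ := hcop
    have := congr_arg (eval z) hab
    rw [eval_add, eval_mul, eval_mul, hpz, hqz, mul_zero, mul_zero, add_zero, eval_one] at this
    exact zero_ne_one this
  refine ⟨?_, ?_⟩
  · -- `f ∉ K`: otherwise `p = c q`, contradicting coprimality and `d ≥ 1`
    rintro ⟨c, hc⟩
    have hpq : aeval x (p - C c * q) = 0 := by
      rw [map_sub, map_mul, aeval_C, hc, hf, div_mul_cancel₀ _ haq, sub_self]
    have hpq' : p = C c * q := sub_eq_zero.1 (hinj (by rw [hpq, map_zero]))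
    have hqunit : IsUnit q :=
      hcop.isUnit_of_dvd' (by rw [hpq']; exact dvd_mul_left q _) dvd_rfl
    have hq' : q.natDegree = 0 := natDegree_eq_zero_of_isUnit hqunit
    have hp' : p.natDegree = 0 := by
      rw [hpq']
      exact le_antisymm ((natDegree_C_mul_le c q).trans hq'.le) (Nat.zero_le _)
    rw [hp', hq', max_self] at hd
    exact lt_irrefl _ hd
  · intro c hc0 hc1 P hP
    -- `f - c = r(x)/q(x)` with `r = p - c q`
    set r : K[X] := p - C c * q with hr
    have hfc : f - algebraMap K W.FunctionField c = aeval x r / aeval x q := by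
      rw [hr, map_sub, map_mul, aeval_C, sub_div, hf, mul_div_cancel_right₀ _ haq]
    have hr0 : r ≠ 0 := by
      intro h0
      rw [hfc, h0, map_zero, zero_div, PlaceOver.ord_zero] at hP
      exact lt_irrefl _ hP
    have har : aeval x r ≠ 0 := fun h ↦ hr0 (hinj (by rw [h, map_zero]))
    rw [hfc] at hP ⊢
    rw [P.ord_div har haq] at hP ⊢
    -- the place is finite
    rcases eq_or_ne P (infPlace W) with rfl | hPinf
    · exfalso
      have hxneg : (infPlace W).ord x < 0 := by rw [hx, ord_infPlace_x]; norm_num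
      obtain ⟨-, hordr⟩ := (infPlace W).ord_aeval_of_ord_neg hxneg hr0
      obtain ⟨-, hordq⟩ := (infPlace W).ord_aeval_of_ord_neg hxneg hq0
      rw [hordr, hordq, hx, ord_infPlace_x] at hP
      -- `deg r ≥ deg q`
      have hdeg : q.natDegree ≤ r.natDegree := by
        rcases lt_trichotomy p.natDegree q.natDegree with hlt | heq | hgt
        · rw [hr, natDegree_sub_eq_right_of_natDegree_lt (by rwa [natDegree_C_mul hc0]),
            natDegree_C_mul hc0]
        · by_contra hlt
          push Not at hlt
          rw [heq, max_self] at hdrop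
          have hpq : (p - q).natDegree < q.natDegree := by
            rcases hdrop with h | h | h
            · omega
            · omega
            · exact h
          have hdiff : ((p - q) - r).natDegree < q.natDegree :=
            lt_of_le_of_lt (natDegree_sub_le _ _) (max_lt hpq hlt)
          have heq2 : (p - q) - r = C (c - 1) * q := by rw [hr, map_sub, map_one]; ring
          rw [heq2, natDegree_C_mul (sub_ne_zero.2 hc1)] at hdiff
          exact lt_irrefl _ hdiff
        · rw [hr, natDegree_sub_eq_left_of_natDegree_lt (by rwa [natDegree_C_mul hc0])]
          exact hgt.le
      have : (q.natDegree : ℤ) ≤ r.natDegree := by exact_mod_cast hdeg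
      nlinarith
    · obtain ⟨α, he⟩ := exists_ord_x_sub_pos W hPinf
      rw [← hx] at he
      obtain ⟨-, hordr⟩ := P.ord_aeval_of_ord_sub_pos he hr0
      obtain ⟨-, hordq⟩ := P.ord_aeval_of_ord_sub_pos he hq0
      set mr : ℕ := (r.comp (X + C α)).rootMultiplicity 0 with hmr
      set mq : ℕ := (q.comp (X + C α)).rootMultiplicity 0 with hmq
      rw [hordr, hordq] at hP ⊢
      have hcompne : ∀ {g : K[X]}, g ≠ 0 → g.comp (X + C α) ≠ 0 := by
        intro g hg h0
        rw [comp_eq_zero_iff] at h0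
        rcases h0 with h0 | ⟨-, h0⟩
        · exact hg h0
        · have := congr_arg (fun q : K[X] ↦ q.coeff 1) h0
          simp at this
      have hroot_iff : ∀ {g : K[X]}, g ≠ 0 →
          (0 < (g.comp (X + C α)).rootMultiplicity 0 ↔ g.eval α = 0) := by
        intro g hg
        rw [rootMultiplicity_pos (hcompne hg), IsRoot.def, eval_comp, eval_add, eval_X, eval_C,
          zero_add]
      -- `r(α) = 0`, hence `q(α) ≠ 0`, `mq = 0`
      have hmr1 : 0 < mr := by
        by_contra h0
        have : mr = 0 := by omega
        rw [this, Nat.cast_zero, zero_mul, zero_sub] at hP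
        have : (0 : ℤ) ≤ mq * P.ord (x - algebraMap K W.FunctionField α) := by positivity
        linarith
      have hrα : r.eval α = 0 := (hroot_iff hr0).1 (by rwa [← hmr])
      have hpα : p.eval α = c * q.eval α := by
        have : r.eval α = p.eval α - c * q.eval α := by rw [hr, eval_sub, eval_mul, eval_C]
        linear_combination this.symm.trans hrα
      have hqα : q.eval α ≠ 0 := fun hq ↦ hcoprime_eval α (by rw [hpα, hq, mul_zero]) hq
      have hmq0 : mq = 0 := by
        by_contra h0
        exact hqα ((hroot_iff hq0).1 (by rw [← hmq]; omega))
      rw [hmq0, Nat.cast_zero, zero_mul, sub_zero] at hP ⊢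
      have hc01 : ¬ (p.eval α = 0 ∨ p.eval α = q.eval α) := by
        rintro (h | h)
        · rw [hpα] at h
          rcases mul_eq_zero.1 h with h | h
          · exact hc0 h
          · exact hqα h
        · rw [hpα] at h
          exact hc1 (mul_right_cancel₀ hqα (by rw [h, one_mul]))
      -- `e = v_P(x - α) = 1`: `α` is not a branch point of `x`
      have hcubic : α ^ 3 + W.a₂ * α ^ 2 + W.a₄ * α + W.a₆ ≠ 0 := by
        intro h0
        have hb := hbranch α h0
        rw [eval_mul, eval_mul, eval_sub] at hb
        rcases mul_eq_zero.1 hb with hb | hb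
        · rcases mul_eq_zero.1 hb with hb | hb
          · exact hc01 (Or.inl hb)
          · exact hqα hb
        · exact hc01 (Or.inr (sub_eq_zero.1 hb))
      have he1 : P.ord (x - algebraMap K W.FunctionField α) = 1 :=
        ord_x_sub_eq_one W h₁ h₃ hcubic he
      -- `mr = 1`: `α` is not a critical point of `β`
      have hmr' : mr = 1 := by
        by_contra hne
        have hlt : 1 < (r.comp (X + C α)).rootMultiplicity 0 := by rw [← hmr]; omega
        rw [one_lt_rootMultiplicity_iff_isRoot (hcompne hr0)] at hlt
        have hd' : (derivative r).eval α = 0 := by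
          have h2 := hlt.2
          rwa [derivative_comp, derivative_add, derivative_X, derivative_C, add_zero, one_mul,
            IsRoot.def, eval_comp, eval_add, eval_X, eval_C, zero_add] at h2
        have hd'' : (derivative p).eval α = c * (derivative q).eval α := by
          have : (derivative r).eval α = (derivative p).eval α - c * (derivative q).eval α := by
            rw [hr, derivative_sub, derivative_mul, derivative_C, zero_mul, zero_add, eval_sub,
              eval_mul, eval_C]
          linear_combination this.symm.trans hd'
        have hw : (derivative p * q - p * derivative q).eval α = 0 := by
          rw [eval_sub, eval_mul, eval_mul, hd'', hpα]; ring
        exact hc01 (hcrit α hqα hw)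
      rw [hmr', he1, Nat.cast_one, one_mul]

omit [IsDedekindDomain W.CoordinateRing] in
/-- `p(x)/q(x) ∉ K` for coprime `p, q` with `max (deg p) (deg q) ≥ 1`. [folklore] -/
theorem aeval_div_not_mem_range {p q : K[X]} (hcop : IsCoprime p q)
    (hd : 0 < max p.natDegree q.natDegree) :
    aeval (xF W) p / aeval (xF W) q ∉ Set.range (algebraMap K W.FunctionField) := by
  set x := (xF W) with hx
  have hxt : Transcendental K x := by
    haveI := isIntegrallyClosedIn_of_isAlgClosed (K := K) (F := W.FunctionField)
    exact transcendental_of_not_mem_range (x_not_mem_range W)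
  have hinj : Function.Injective (aeval x : K[X] →ₐ[K] W.FunctionField) :=
    (transcendental_iff_injective.1 hxt)
  have hq0 : q ≠ 0 := by
    rintro rfl
    have hpunit : IsUnit p := isCoprime_zero_right.1 hcop
    rw [natDegree_eq_zero_of_isUnit hpunit, natDegree_zero, max_self] at hd
    exact lt_irrefl _ hd
  have haq : aeval x q ≠ 0 := fun h ↦ hq0 (hinj (by rw [h, map_zero]))
  rintro ⟨c, hc⟩
  have hpq : aeval x (p - C c * q) = 0 := by
    rw [map_sub, map_mul, aeval_C, hc, div_mul_cancel₀ _ haq, sub_self]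
  have hpq' : p = C c * q := sub_eq_zero.1 (hinj (by rw [hpq, map_zero]))
  have hqunit : IsUnit q :=
    hcop.isUnit_of_dvd' (by rw [hpq']; exact dvd_mul_left q _) dvd_rfl
  have hq' : q.natDegree = 0 := natDegree_eq_zero_of_isUnit hqunit
  have hp' : p.natDegree = 0 := by
    rw [hpq']
    exact le_antisymm ((natDegree_C_mul_le c q).trans hq'.le) (Nat.zero_le _)
  rw [hp', hq', max_self] at hd
  exact lt_irrefl _ hd

/-- **The degree of `p(x)/q(x)` on `K(W)` is `2 · max (deg p) (deg q)`** (`p, q` coprime): counting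
poles — over each root `α` of `q` the fibre of `x` contributes `2 · mult_α(q)`
(`Σ_{P | α} e_P = [K(W) : K(x)] = 2`), and `P_∞` contributes `2 (deg p - deg q)` when
`deg p > deg q`.
[cite: SilvermanAEC2009, Cor. III.3.1.1] -/
theorem finrank_adjoin_aeval_div [CharZero K] {p q : K[X]} (hcop : IsCoprime p q)
    (hd : 0 < max p.natDegree q.natDegree) :
    Module.finrank K⟮aeval (xF W) p / aeval (xF W) q⟯ W.FunctionField =
      2 * max p.natDegree q.natDegree := by
  classical
  have hrat : ∀ P : PlaceOver K W.FunctionField, P.IsRational :=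
    PlaceOver.isRational_of_isAlgClosed
  set x := (xF W) with hx
  have hxK : x ∉ Set.range (algebraMap K W.FunctionField) := x_not_mem_range W
  have hxt : Transcendental K x := by
    haveI := isIntegrallyClosedIn_of_isAlgClosed (K := K) (F := W.FunctionField)
    exact transcendental_of_not_mem_range hxK
  have hinj : Function.Injective (aeval x : K[X] →ₐ[K] W.FunctionField) :=
    (transcendental_iff_injective.1 hxt)
  have hq0 : q ≠ 0 := by
    rintro rfl
    have hpunit : IsUnit p := isCoprime_zero_right.1 hcop
    rw [natDegree_eq_zero_of_isUnit hpunit, natDegree_zero, max_self] at hd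
    exact lt_irrefl _ hd
  have hp0 : p ≠ 0 := by
    rintro rfl
    have hqunit : IsUnit q := isCoprime_zero_left.1 hcop
    rw [natDegree_eq_zero_of_isUnit hqunit, natDegree_zero, max_self] at hd
    exact lt_irrefl _ hd
  have haq : aeval x q ≠ 0 := fun h ↦ hq0 (hinj (by rw [h, map_zero]))
  have hap : aeval x p ≠ 0 := fun h ↦ hp0 (hinj (by rw [h, map_zero]))
  set f := aeval x p / aeval x q with hf
  have hfK : f ∉ Set.range (algebraMap K W.FunctionField) := aeval_div_not_mem_range W hcop hd
  have hcoprime_eval : ∀ z : K, p.eval z = 0 → q.eval z = 0 → False := by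
    intro z hpz hqz
    obtain ⟨a, b, hab⟩ := hcop
    have := congr_arg (eval z) hab
    rw [eval_add, eval_mul, eval_mul, hpz, hqz, mul_zero, mul_zero, add_zero, eval_one] at this
    exact zero_ne_one this
  -- orders of `f`
  have hordf : ∀ P : PlaceOver K W.FunctionField, P.ord f = P.ord (aeval x p) - P.ord (aeval x q) :=
    fun P ↦ P.ord_div hap haq
  -- the fibres of `x`
  set Fib : K → Finset (PlaceOver K W.FunctionField) := fun α ↦
    (finite_setOf_ord_ne_zero_holds (K := K)
      (sub_ne_zero.2 fun h ↦ hxK ⟨α, h.symm⟩ :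
        x - algebraMap K W.FunctionField α ≠ 0)).toFinset.filter
      fun P ↦ 0 < P.ord (x - algebraMap K W.FunctionField α) with hFib
  have hmemFib : ∀ α P, P ∈ Fib α ↔ 0 < P.ord (x - algebraMap K W.FunctionField α) := fun α P ↦ by
    rw [hFib, Finset.mem_filter, Set.Finite.mem_toFinset, Set.mem_setOf_eq]
    exact ⟨fun h ↦ h.2, fun h ↦ ⟨h.ne', h⟩⟩
  have hFibsum : ∀ α, ∑ P ∈ Fib α, P.ord (x - algebraMap K W.FunctionField α) = 2 := by
    intro α
    have h := sum_ord_sub_eq_finrank hrat hxK α (Fib α) (fun P hP ↦ (hmemFib α P).1 hP)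
      (fun P hP ↦ (hmemFib α P).2 hP)
    rw [hx, finrank_adjoin_x] at h
    exact_mod_cast h
  have hFibdisj : ∀ (T : Finset K), (T : Set K).PairwiseDisjoint Fib := by
    intro T α _ α' _ hne
    rw [Function.onFun, Finset.disjoint_left]
    intro P hP hP'
    have h1 := (hmemFib α P).1 hP
    have h2 := (hmemFib α' P).1 hP'
    have hne0 : x - algebraMap K W.FunctionField α ≠ 0 := sub_ne_zero.2 fun h ↦ hxK ⟨α, h.symm⟩
    have hne0' : x - algebraMap K W.FunctionField α' ≠ 0 := sub_ne_zero.2 fun h ↦ hxK ⟨α', h.symm⟩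
    exact hne (ne_of_valuation_x_sub_lt W ((P.valuation_lt_one_iff_ord_pos hne0).2 h1)
      ((P.valuation_lt_one_iff_ord_pos hne0').2 h2))
  -- orders at a place of the fibre over `α`
  have hfinite : ∀ α, ∀ P ∈ Fib α,
      P.ord f = ((p.rootMultiplicity α : ℤ) - q.rootMultiplicity α) *
        P.ord (x - algebraMap K W.FunctionField α) := by
    intro α P hP
    have he := (hmemFib α P).1 hP
    obtain ⟨-, h1⟩ := P.ord_aeval_of_ord_sub_pos he hp0
    obtain ⟨-, h2⟩ := P.ord_aeval_of_ord_sub_pos he hq0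
    rw [hordf, h1, h2, ← rootMultiplicity_eq_rootMultiplicity,
      ← rootMultiplicity_eq_rootMultiplicity]
    ring
  -- the order at infinity
  have hxneg : (infPlace W).ord x < 0 := by rw [hx, ord_infPlace_x]; norm_num
  have hinf : (infPlace W).ord f = 2 * ((q.natDegree : ℤ) - p.natDegree) := by
    obtain ⟨-, h1⟩ := (infPlace W).ord_aeval_of_ord_neg hxneg hp0
    obtain ⟨-, h2⟩ := (infPlace W).ord_aeval_of_ord_neg hxneg hq0
    rw [hordf, h1, h2, hx, ord_infPlace_x]
    ring
  -- the pole set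
  set Ufin : Finset (PlaceOver K W.FunctionField) := q.roots.toFinset.biUnion Fib with hUfin
  set Uinf : Finset (PlaceOver K W.FunctionField) :=
    if q.natDegree < p.natDegree then {infPlace W} else ∅ with hUinf
  have hinfFib : ∀ α, infPlace W ∉ Fib α := by
    intro α h
    have he := (hmemFib α _).1 h
    have hmem : x - algebraMap K W.FunctionField α ∈ (infPlace W).toValuationSubring :=
      PlaceOver.mem_of_ord_pos _ he
    have : x ∈ (infPlace W).toValuationSubring := by
      simpa using add_mem hmem ((infPlace W).algebraMap_mem α)
    exact x_not_mem_infPlace W (by rw [hx] at this; exact this)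
  have hdisjU : Disjoint Ufin Uinf := by
    rw [hUinf]
    split_ifs
    · rw [Finset.disjoint_singleton_right, hUfin, Finset.mem_biUnion]
      rintro ⟨α, -, h⟩
      exact hinfFib α h
    · exact Finset.disjoint_empty_right _
  have hU : ∀ P ∈ Ufin ∪ Uinf, P.ord f < 0 := by
    intro P hP
    rcases Finset.mem_union.1 hP with hP | hP
    · rw [hUfin, Finset.mem_biUnion] at hP
      obtain ⟨α, hα, hPα⟩ := hP
      rw [Multiset.mem_toFinset, mem_roots hq0, IsRoot.def] at hα
      have hqm : 0 < q.rootMultiplicity α := (rootMultiplicity_pos hq0).2 hα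
      have hpm : p.rootMultiplicity α = 0 := by
        by_contra h
        exact hcoprime_eval α ((rootMultiplicity_pos hp0).1 (Nat.pos_of_ne_zero h)) hα
      rw [hfinite α P hPα, hpm]
      have he := (hmemFib α P).1 hPα
      have : (0 : ℤ) < q.rootMultiplicity α := by exact_mod_cast hqm
      push_cast
      nlinarith [mul_pos this he]
    · rw [hUinf] at hP
      split_ifs at hP with hlt
      · rw [Finset.mem_singleton.1 hP, hinf]
        have : (q.natDegree : ℤ) < p.natDegree := by exact_mod_cast hlt
        linarith
      · simp at hP
  have hcomp : ∀ P : PlaceOver K W.FunctionField, P.ord f < 0 → P ∈ Ufin ∪ Uinf := by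
    intro P hP
    rcases eq_or_ne P (infPlace W) with rfl | hPinf
    · refine Finset.mem_union_right _ ?_
      rw [hUinf]
      split_ifs with hlt
      · exact Finset.mem_singleton_self _
      · exfalso
        rw [hinf] at hP
        have : (p.natDegree : ℤ) ≤ q.natDegree := by exact_mod_cast not_lt.1 hlt
        linarith
    · obtain ⟨α, he⟩ := exists_ord_x_sub_pos W hPinf
      rw [← hx] at he
      have hPα : P ∈ Fib α := (hmemFib α P).2 he
      rw [hfinite α P hPα] at hP
      have hqm : 0 < q.rootMultiplicity α := by
        by_contra h
        have h0 : q.rootMultiplicity α = 0 := by omega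
        rw [h0, Nat.cast_zero, sub_zero] at hP
        have : (0 : ℤ) ≤ p.rootMultiplicity α * P.ord (x - algebraMap K W.FunctionField α) := by
          positivity
        linarith
      refine Finset.mem_union_left _ ?_
      rw [hUfin, Finset.mem_biUnion]
      refine ⟨α, ?_, hPα⟩
      rw [Multiset.mem_toFinset, mem_roots hq0, IsRoot.def]
      exact (rootMultiplicity_pos hq0).1 hqm
  -- the pole count
  have hsum := sum_neg_ord_eq_finrank hrat hfK (Ufin ∪ Uinf) hU hcomp
  rw [Finset.sum_union hdisjU] at hsum
  -- finite part: `2 deg q`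
  have hfinsum : ∑ P ∈ Ufin, -P.ord f = 2 * q.natDegree := by
    rw [hUfin, Finset.sum_biUnion (hFibdisj _)]
    have hα : ∀ α ∈ q.roots.toFinset, ∑ P ∈ Fib α, -P.ord f = 2 * q.rootMultiplicity α := by
      intro α hα
      rw [Multiset.mem_toFinset, mem_roots hq0, IsRoot.def] at hα
      have hpm : p.rootMultiplicity α = 0 := by
        by_contra h
        exact hcoprime_eval α ((rootMultiplicity_pos hp0).1 (Nat.pos_of_ne_zero h)) hα
      rw [Finset.sum_congr rfl fun P hP ↦ by rw [hfinite α P hP, hpm], ← hFibsum α,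
        Finset.sum_mul]
      refine Finset.sum_congr rfl fun P _ ↦ ?_
      push_cast
      ring
    rw [Finset.sum_congr rfl hα, ← Finset.mul_sum]
    congr 1
    have h1 : ∑ α ∈ q.roots.toFinset, (q.rootMultiplicity α : ℤ) = (q.roots.card : ℤ) := by
      rw [← Multiset.toFinset_sum_count_eq]
      push_cast
      exact Finset.sum_congr rfl fun α _ ↦ by rw [count_roots]
    rw [h1, IsAlgClosed.card_roots_eq_natDegree]
  -- infinite part
  have hinfsum : ∑ P ∈ Uinf, -P.ord f = 2 * ((p.natDegree : ℤ) - q.natDegree) ⊔ 0 := by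
    rw [hUinf]
    split_ifs with hlt
    · rw [Finset.sum_singleton, hinf]
      have : (q.natDegree : ℤ) < p.natDegree := by exact_mod_cast hlt
      rw [max_eq_left (by linarith)]
      ring
    · rw [Finset.sum_empty]
      have : (p.natDegree : ℤ) ≤ q.natDegree := by exact_mod_cast not_lt.1 hlt
      rw [max_eq_right (by linarith)]
  rw [hfinsum, hinfsum] at hsum
  -- `2 deg q + max(2 (deg p - deg q), 0) = 2 max (deg p) (deg q)`
  have hZ : (2 * q.natDegree : ℤ) + 2 * ((p.natDegree : ℤ) - q.natDegree) ⊔ 0 =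
      2 * ((max p.natDegree q.natDegree : ℕ) : ℤ) := by
    push_cast
    omega
  have : (Module.finrank K⟮f⟯ W.FunctionField : ℤ) =
      2 * ((max p.natDegree q.natDegree : ℕ) : ℤ) := by
    rw [← hsum, hZ]
  exact_mod_cast this

/-- **`deg_B(E) ≤ 2 · deg β`** for every rational Belyi map `β = p/q` of `ℙ¹` sending the four
branch points `e₁, e₂, e₃, ∞` of the double cover `x : E → ℙ¹` into `{0, 1, ∞}` (hypotheses of
`isBelyiFunction_aeval_div`). [cite: Javanpeykar2014, §1.1] -/
theorem belyiDegree_le_two_mul [W.IsElliptic] [CharZero K] (h₁ : W.a₁ = 0) (h₃ : W.a₃ = 0)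
    {p q : K[X]} (hcop : IsCoprime p q) (hd : 0 < max p.natDegree q.natDegree)
    (hdrop : p.natDegree < max p.natDegree q.natDegree ∨ q.natDegree < max p.natDegree q.natDegree ∨
      (p - q).natDegree < max p.natDegree q.natDegree)
    (hcrit : ∀ z : K, q.eval z ≠ 0 → (derivative p * q - p * derivative q).eval z = 0 →
      p.eval z = 0 ∨ p.eval z = q.eval z)
    (hbranch : ∀ z : K, z ^ 3 + W.a₂ * z ^ 2 + W.a₄ * z + W.a₆ = 0 → (p * q * (p - q)).eval z = 0) :
    belyiDegree K W.FunctionField ≤ 2 * max p.natDegree q.natDegree := by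
  have h := belyiDegree_le_finrank (isBelyiFunction_aeval_div W h₁ h₃ hcop hd hdrop hcrit hbranch)
  rwa [finrank_adjoin_aeval_div W hcop hd] at h

/-- **The Legendre curve `E_λ : y² = x(x - 1)(x - λ)` and the four-pointed line `(ℙ¹; 0, 1, ∞, λ)`:
`deg_B(E_λ) ≤ 2d` for every Belyi witness `β = p/q` of degree `d` for `λ` with coefficients in `K`**
— the clauses are those of `HasBelyiWitness d λ` (`BelyiDegree.lean`: `∞` special, the
Riemann–Hurwitz/critical-value condition in its critical-value form, and `0, 1, λ` special), here
over the algebraically closed field `K` carrying the curve. [cite: Javanpeykar2014, §1.1] -/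
theorem belyiDegree_legendre_le [W.IsElliptic] [CharZero K] {lam : K} (h₁ : W.a₁ = 0)
    (h₂ : W.a₂ = -(1 + lam)) (h₃ : W.a₃ = 0) (h₄ : W.a₄ = lam) (h₆ : W.a₆ = 0)
    {p q : K[X]} (hcop : IsCoprime p q) (hd : 0 < max p.natDegree q.natDegree)
    (hdrop : p.natDegree < max p.natDegree q.natDegree ∨ q.natDegree < max p.natDegree q.natDegree ∨
      (p - q).natDegree < max p.natDegree q.natDegree)
    (hcrit : ∀ z : K, q.eval z ≠ 0 → (derivative p * q - p * derivative q).eval z = 0 →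
      p.eval z = 0 ∨ p.eval z = q.eval z)
    (h0 : (p * q * (p - q)).eval 0 = 0) (h1 : (p * q * (p - q)).eval 1 = 0)
    (hlam : (p * q * (p - q)).eval lam = 0) :
    belyiDegree K W.FunctionField ≤ 2 * max p.natDegree q.natDegree := by
  refine belyiDegree_le_two_mul W h₁ h₃ hcop hd hdrop hcrit fun z hz ↦ ?_
  rw [h₂, h₄, h₆] at hz
  have hz' : z * (z - 1) * (z - lam) = 0 := by linear_combination hz
  rcases mul_eq_zero.1 hz' with hz'' | hz''
  · rcases mul_eq_zero.1 hz'' with h | h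
    · rw [h]; exact h0
    · rw [sub_eq_zero.1 h]; exact h1
  · rw [sub_eq_zero.1 hz'']; exact hlam

/-! ### Belyi's polynomials `c x^A (1 - x)^B`: `deg_B(E_λ) ≤ 2 (A + B)` for `λ = A/(A + B)` -/

/-- **`deg_B(E_λ) ≤ 2 (m + n + 2)` for the Legendre curve with `λ = (m+1)/(m+n+2)`** — Belyi's
polynomial `β = λ^{-(m+1)} (1-λ)^{-(n+1)} x^{m+1} (1-x)^{n+1}` of degree `m + n + 2` is a Belyi map
of `ℙ¹` with `β(0) = β(1) = 0`, `β(λ) = 1`, `β(∞) = ∞` and finite critical values in `{0, 1}`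
(`BelyiAlgorithm.belyiPoly_critical`, Bombieri–Gubler p. 406), so `β(x)` is a Belyi function of
degree `2(m + n + 2)` on `E_λ` (`belyiDegree_legendre_le`). Thus **`deg_B(E_{a/c}) ≤ 2c`** for
`0 < a < c` — the genus-one form of the trivial bound `deg_B(ℙ¹; 0, 1, ∞, a/c) ≤ c`. (Here `K` is
algebraically closed of characteristic `0` with an embedding `ι : K → ℂ`, used only to import the
critical-value computation stated over `ℂ`.)
[cite: BombieriGubler2006, Lemma 12.2.7 (proof, p. 406)] -/
theorem belyiDegree_legendre_le_of_eq_div [W.IsElliptic] [CharZero K] (ι : K →+* ℂ) (m n : ℕ)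
    (h₁ : W.a₁ = 0) (h₂ : W.a₂ = -(1 + algebraMap ℚ K ((m + 1 : ℚ) / (m + n + 2 : ℚ))))
    (h₃ : W.a₃ = 0) (h₄ : W.a₄ = algebraMap ℚ K ((m + 1 : ℚ) / (m + n + 2 : ℚ))) (h₆ : W.a₆ = 0) :
    belyiDegree K W.FunctionField ≤ 2 * (m + n + 2) := by
  set lam : ℚ := (m + 1 : ℚ) / (m + n + 2 : ℚ) with hlam
  have hmn : (0 : ℚ) < m + n + 2 := by positivity
  have hlam0 : lam ≠ 0 := by rw [hlam]; positivity
  have hlam1 : lam ≠ 1 := by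
    rw [hlam, Ne, div_eq_one_iff_eq hmn.ne']
    intro h
    have hn : (0 : ℚ) < n + 1 := by positivity
    linarith
  set c : ℚ := (lam ^ (m + 1) * (1 - lam) ^ (n + 1))⁻¹ with hc
  have hc0 : c ≠ 0 := inv_ne_zero (mul_ne_zero (pow_ne_zero _ hlam0)
    (pow_ne_zero _ (sub_ne_zero.2 (Ne.symm hlam1))))
  set h : ℚ[X] := C c * X ^ (m + 1) * (1 - X) ^ (n + 1) with hh
  set p : K[X] := h.map (algebraMap ℚ K) with hp
  -- degree
  have h1X : (1 - X : ℚ[X]) ≠ 0 := by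
    intro h0
    have := congr_arg (eval 0) h0
    simp at this
  have hhdeg : h.natDegree = m + n + 2 := by
    have e1 : (1 - X : ℚ[X]).natDegree = 1 := by
      rw [show (1 - X : ℚ[X]) = -(X - C 1) by rw [map_one]; ring, natDegree_neg, natDegree_X_sub_C]
    rw [hh, natDegree_mul (mul_ne_zero (C_ne_zero.2 hc0) (pow_ne_zero _ X_ne_zero))
      (pow_ne_zero _ h1X), natDegree_C_mul_X_pow _ _ hc0, natDegree_pow, e1]
    ring
  have hpdeg : p.natDegree = m + n + 2 := by rw [hp, natDegree_map, hhdeg]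
  have hmax : max p.natDegree (1 : K[X]).natDegree = m + n + 2 := by
    rw [natDegree_one, hpdeg, Nat.max_eq_left (Nat.zero_le _)]
  -- evaluations transported from `ℚ`
  have hpeval : ∀ r : ℚ, p.eval (algebraMap ℚ K r) = algebraMap ℚ K (h.eval r) := fun r ↦ by
    rw [hp, eval_map_algebraMap, aeval_algebraMap_apply, aeval_def, eval₂_eq_eval_map,
      Algebra.algebraMap_self, Polynomial.map_id]
  have hp0 : p.eval 0 = 0 := by
    have e := hpeval 0
    rwa [map_zero, (BelyiAlgorithm.belyiPoly_eval_zero_one c m n).1, map_zero] at e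
  have hp1 : p.eval 1 = 0 := by
    have e := hpeval 1
    rwa [map_one, (BelyiAlgorithm.belyiPoly_eval_zero_one c m n).2, map_zero] at e
  have hplam : p.eval (algebraMap ℚ K lam) = 1 := by
    rw [hpeval, hh, hc, BelyiAlgorithm.belyiPoly_eval_lambda hlam0 hlam1 m n, map_one]
  -- critical values, via `ι : K → ℂ`
  set ι' : K →ₐ[ℚ] ℂ := ι.toRatAlgHom with hι'
  have hιaeval : ∀ (z : K) (g : ℚ[X]), ι (aeval z g) = aeval (ι z) g := fun z g ↦ by
    have e1 : (ι' : K → ℂ) = ι := rfl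
    rw [← e1, aeval_algHom_apply]
  have hcrit : ∀ z : K, (1 : K[X]).eval z ≠ 0 → (derivative p * 1 - p * derivative 1).eval z = 0 →
      p.eval z = 0 ∨ p.eval z = (1 : K[X]).eval z := by
    intro z _ hz
    rw [derivative_one, mul_zero, sub_zero, mul_one, hp, Polynomial.derivative_map,
      eval_map_algebraMap] at hz
    rw [eval_one, hp, eval_map_algebraMap]
    have hw : aeval (ι z) (derivative h) = 0 := by rw [← hιaeval, hz, map_zero]
    have hc' := BelyiAlgorithm.belyiPoly_critical (q := lam) (m := m) (n := n) rfl (ι z) hw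
    rcases hc' with hc' | hc'
    · left; apply ι.injective; rw [hιaeval, map_zero]; exact hc'
    · right; apply ι.injective; rw [hιaeval, map_one]; exact hc'
  have h := belyiDegree_legendre_le W (lam := algebraMap ℚ K lam) h₁ h₂ h₃ h₄ h₆
    (isCoprime_one_right (x := p)) (by rw [hmax]; positivity)
    (Or.inr (Or.inl (by rw [hmax, natDegree_one]; positivity))) hcrit
    (by rw [eval_mul, eval_mul, hp0, zero_mul, zero_mul])
    (by rw [eval_mul, eval_mul, hp1, zero_mul, zero_mul])
    (by rw [eval_mul, eval_sub, eval_one, hplam, sub_self, mul_zero])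
  rwa [hmax] at h

end WeierstrassBelyi

/-! ### The Legendre–Frey curves over number fields -/

/-- **`deg_B(E_{λ,Ω}) ≤ 2(m + n + 2)`, `λ = (m+1)/(m+n+2)`, for the Legendre curve over a number
field** (`Ω` an algebraic closure): the Belyi degree in `javanpeykar2014_stableFaltingsHeight_le` of
the Legendre/Frey curve `y² = x(x - 1)(x - a/c)` is at most `2c`.
[cite: BombieriGubler2006, Lemma 12.2.7 (proof, p. 406)] -/
theorem belyiDegree_legendre_baseChange_le (K : Type) [Field K] [NumberField K] (m n : ℕ)
    (W : WeierstrassCurve K) [W.IsElliptic] (h₁ : W.a₁ = 0)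
    (h₂ : W.a₂ = -(1 + algebraMap ℚ K ((m + 1 : ℚ) / (m + n + 2 : ℚ)))) (h₃ : W.a₃ = 0)
    (h₄ : W.a₄ = algebraMap ℚ K ((m + 1 : ℚ) / (m + n + 2 : ℚ))) (h₆ : W.a₆ = 0)
    (Ω : Type) [Field Ω] [Algebra K Ω] [IsAlgClosure K Ω] :
    belyiDegree Ω (W.baseChange Ω).toAffine.FunctionField ≤ 2 * (m + n + 2) := by
  haveI : IsAlgClosed Ω := IsAlgClosure.isAlgClosed K
  haveI : CharZero Ω := charZero_of_injective_algebraMap (algebraMap K Ω).injective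
  haveI : (W.baseChange Ω).IsElliptic := by rw [WeierstrassCurve.baseChange]; infer_instance
  haveI : Algebra.IsAlgebraic K Ω := IsAlgClosure.isAlgebraic
  haveI : Algebra.IsAlgebraic ℚ K := Algebra.IsAlgebraic.of_finite ℚ K
  haveI : Algebra.IsAlgebraic ℚ Ω := Algebra.IsAlgebraic.trans ℚ K Ω
  let ι : Ω →ₐ[ℚ] ℂ := IsAlgClosed.lift
  have hq : ∀ r : ℚ, algebraMap K Ω (algebraMap ℚ K r) = algebraMap ℚ Ω r := fun r ↦ by
    rw [← RingHom.comp_apply, eq_ratCast, eq_ratCast]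
  refine WeierstrassBelyi.belyiDegree_legendre_le_of_eq_div (W.baseChange Ω).toAffine ι.toRingHom
    m n (by simp [WeierstrassCurve.baseChange, h₁]) ?_
    (by simp [WeierstrassCurve.baseChange, h₃]) ?_
    (by simp [WeierstrassCurve.baseChange, h₆])
  · simp only [WeierstrassCurve.baseChange, WeierstrassCurve.map, h₂, map_neg, map_add, map_one]
    rw [hq]
  · simp only [WeierstrassCurve.baseChange, WeierstrassCurve.map, h₄]
    rw [hq]

/-- **Javanpeykar's bound on the Legendre/Frey curves, in closed form (modulo the named fact):**
`h_F(E_λ) ≤ 13·10⁶ · (2(m + n + 2))⁵` for `λ = (m+1)/(m+n+2)`, i.e. `h_F(E_{a/c}) ≤ 4.16·10⁸ c⁵` for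
`0 < a < c`. [cite: Javanpeykar2014, Thm 1.1.1] -/
theorem javanpeykar2014_stableFaltingsHeight_le.legendre
    (h : javanpeykar2014_stableFaltingsHeight_le)
    (K : Type) [Field K] [NumberField K] (m n : ℕ) (W : WeierstrassCurve K) [W.IsElliptic]
    (h₁ : W.a₁ = 0) (h₂ : W.a₂ = -(1 + algebraMap ℚ K ((m + 1 : ℚ) / (m + n + 2 : ℚ))))
    (h₃ : W.a₃ = 0) (h₄ : W.a₄ = algebraMap ℚ K ((m + 1 : ℚ) / (m + n + 2 : ℚ))) (h₆ : W.a₆ = 0) :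
    W.stableFaltingsHeight ≤ 13 * 10 ^ 6 * (2 * (m + n + 2) : ℝ) ^ 5 := by
  have hb := h.le_belyiDegree_pow' K W (AlgebraicClosure K)
  have hd : (belyiDegree (AlgebraicClosure K)
      (W.baseChange (AlgebraicClosure K)).toAffine.FunctionField : ℝ) ≤ 2 * (m + n + 2) := by
    exact_mod_cast belyiDegree_legendre_baseChange_le K m n W h₁ h₂ h₃ h₄ h₆ (AlgebraicClosure K)
  refine hb.trans ?_
  gcongr

end Literature.NumberTheory.DiophantineGeometry

end
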